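import Literature.MathematicalPhysics.KineticTheory.CollisionTubePullbackDefs
import Literature.Analysis.FluidPDE.LiouvilleBBGKY
import HarnessLib

/-!
# The collision-cylinder pull-back along hard-sphere orbits, VIII: packing of the near-contact shell

Hard-sphere packing: finitely many points of `ℝ³` of norm `≤ R`, pairwise `≥ ε` apart, are at most
`(2R/ε + 1)³` (`card_le_of_separated`, disjoint balls); hence in the hard-sphere domain every particle
has at most `125` neighbours in the shell `ε < ‖q‖ ≤ 2ε` (`shellCount_le`; differences of minimal
images are images of separations, `Torus.norm_reprSym_proj_le`) and `pairShellCount ≤ 125 (N+1)`.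
Consequently the late-pair remainder of the pull-back is deterministically `O(ε_N)` along good orbits,
in the frame of the crux line (`residual_latePairs`; the bad set is `localGibbsLaw`-null,
`localGibbsLaw_goodCompl`).

## References

* C. Cercignani, R. Illner, M. Pulvirenti, *The Mathematical Theory of Dilute Gases* (1994), §2.2
  (Boltzmann's collision cylinder: the molecules about to hit a given one within time `dt` fill the
  cylinder of height `|V · n| dt` over the protection sphere; pre-collisional hemisphere `V · n < 0`).
  [CIPDiluteGases1994]
* I. Gallagher, L. Saint-Raymond, B. Texier, *From Newton to Boltzmann* (2013), Part II Ch. 4, §4.1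
  (the hard-sphere flow: free flow between collisions, elastic reflection at `|xᵢ − xⱼ| = ε`,
  pre-collisional iff `νⁱʲ · (vᵢ − vⱼ) < 0`; Prop. 4.1.1, Def. 4.1.2). [GallagherSaintRaymondTexier2013]
-/

noncomputable section

open scoped BigOperators Classical InnerProductSpace ENNReal Topology
open Set MeasureTheory Filter Function
open Literature.Analysis.FluidPDE

namespace Literature.MathematicalPhysics.KineticTheory

/-! ## Hard-sphere packing: the near-contact shell holds at most `125` particles -/

section Packing

/-- **Packing in `ℝ³`.**  Finitely many points of norm `≤ R` that are pairwise `≥ ε` apart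
(`ε > 0`) are at most `(2R/ε + 1)³`: the balls of radius `ε/2` about them are disjoint and lie in
the ball of radius `R + ε/2`. [folklore] -/
theorem card_le_of_separated {ι : Type*} (s : Finset ι) (q : ι → V3) {ε R : ℝ} (hε : 0 < ε)
    (hR0 : 0 ≤ R) (hR : ∀ j ∈ s, ‖q j‖ ≤ R)
    (hsep : ∀ j ∈ s, ∀ j' ∈ s, j ≠ j' → ε ≤ ‖q j - q j'‖) :
    (s.card : ℝ) ≤ (2 * R / ε + 1) ^ 3 := by
  have hdisj : Set.PairwiseDisjoint (↑s : Set ι) (fun j => Metric.ball (q j) (ε / 2)) := by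
    intro j hj j' hj' hne
    rw [Function.onFun, Set.disjoint_left]
    intro x hx hx'
    rw [Metric.mem_ball] at hx hx'
    have hlt : ‖q j - q j'‖ < ε := by
      calc ‖q j - q j'‖ = dist (q j) (q j') := (dist_eq_norm _ _).symm
        _ ≤ dist (q j) x + dist x (q j') := dist_triangle _ _ _
        _ < ε / 2 + ε / 2 := add_lt_add (by rwa [dist_comm]) hx'
        _ = ε := by ring
    exact (not_le.2 hlt) (hsep j hj j' hj' hne)
  have hsub : (⋃ j ∈ s, Metric.ball (q j) (ε / 2)) ⊆ Metric.ball (0 : V3) (R + ε / 2) := by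
    intro x hx
    simp only [Set.mem_iUnion] at hx
    obtain ⟨j, hj, hx⟩ := hx
    rw [Metric.mem_ball, dist_eq_norm] at hx
    rw [Metric.mem_ball, dist_zero_right]
    calc ‖x‖ = ‖(x - q j) + q j‖ := by rw [sub_add_cancel]
      _ ≤ ‖x - q j‖ + ‖q j‖ := norm_add_le _ _
      _ < ε / 2 + R := add_lt_add_of_lt_of_le hx (hR j hj)
      _ = R + ε / 2 := by ring
  have hvol := measure_mono (μ := (volume : Measure V3)) hsub
  rw [measure_biUnion_finset hdisj (fun j _ => measurableSet_ball)] at hvol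
  have hdim : Module.finrank ℝ V3 = 3 := finrank_euclideanSpace_fin
  simp only [Measure.addHaar_ball_of_pos (volume : Measure V3) _ (half_pos hε),
    Measure.addHaar_ball_of_pos (volume : Measure V3) _ (by linarith : 0 < R + ε / 2), hdim,
    Finset.sum_const, nsmul_eq_mul] at hvol
  -- `hvol : card * (ofReal ((ε/2)^3) * B) ≤ ofReal ((R + ε/2)^3) * B`, `B = volume (ball 0 1)`
  have hB0 : (volume : Measure V3) (Metric.ball 0 1) ≠ 0 := (Metric.measure_ball_pos volume (0 : V3) one_pos).ne'
  have hBtop : (volume : Measure V3) (Metric.ball 0 1) ≠ ⊤ := measure_ball_lt_top.ne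
  rw [← mul_assoc, ENNReal.mul_le_mul_iff_left hB0 hBtop] at hvol
  have hfin : ENNReal.ofReal ((R + ε / 2) ^ 3) ≠ ⊤ := ENNReal.ofReal_ne_top
  have hreal := ENNReal.toReal_mono hfin hvol
  rw [ENNReal.toReal_mul, ENNReal.toReal_natCast, ENNReal.toReal_ofReal (by positivity),
    ENNReal.toReal_ofReal (by positivity)] at hreal
  have hε2 : 0 < (ε / 2) ^ 3 := by positivity
  rw [← le_div_iff₀ hε2] at hreal
  refine hreal.trans (le_of_eq ?_)
  rw [← div_pow]
  congr 1
  field_simp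

variable {σ : ℝ} {N : ℕ}

/-- **At most `125` particles in the near-contact shell.**  For a configuration in the hard-sphere
domain (all minimal-image separations `≥ ε > 0`) and `2 L κ ≤ 1` (shell outer radius `≤ 2ε`), every
particle has at most `125 = (2·2 + 1)³` shell neighbours: their minimal-image vectors are pairwise
`≥ ε` apart (a difference of minimal images is an image of the separation, `norm_reprSym_proj_le`).
[folklore] -/
theorem shellCount_le {L κ : ℝ} (hε : 0 < hsDiameter σ N) (hLκ : 2 * L * κ ≤ 1)
    {ζ : Config (N + 1) (Fin 3) T3} (hζ : ζ ∈ hardSphereDomain (Torus.geometry (Fin 3)) (N + 1) (hsDiameter σ N))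
    (p : Fin (N + 1)) : shellCount σ N L κ ζ p ≤ 125 := by
  classical
  set s : Finset (Fin (N + 1)) := Finset.univ.filter fun l =>
    hsDiameter σ N < ‖sepAt ζ p l‖ ∧ ‖sepAt ζ p l‖ ≤ hsDiameter σ N * (1 + 2 * L * κ) with hs
  have hcount : shellCount σ N L κ ζ p = (s.card : ℝ) := by
    unfold shellCount shellInd
    rw [Finset.card_eq_sum_ones, Nat.cast_sum, hs, Finset.sum_filter]
    simp only [Nat.cast_one]
  rw [hcount]
  have hR : ∀ j ∈ s, ‖sepAt ζ p j‖ ≤ 2 * hsDiameter σ N := by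
    intro j hj
    have h := (Finset.mem_filter.1 hj).2.2
    nlinarith
  have hsep : ∀ j ∈ s, ∀ j' ∈ s, j ≠ j' → hsDiameter σ N ≤ ‖sepAt ζ p j - sepAt ζ p j'‖ := by
    intro j _ j' _ hne
    have hproj : Literature.Analysis.FunctionSpaces.Torus.proj (sepAt ζ p j - sepAt ζ p j') = (ζ j').1 - (ζ j).1 := by
      unfold sepAt
      rw [Torus.geometry_sepVec, Torus.geometry_sepVec, sub_eq_add_neg,
        Literature.Analysis.FunctionSpaces.Torus.proj_add, Literature.Analysis.FunctionSpaces.Torus.proj_neg,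
        Torus.proj_reprSym, Torus.proj_reprSym]
      abel
    have hmin := Torus.norm_reprSym_proj_le (sepAt ζ p j - sepAt ζ p j')
    rw [hproj] at hmin
    have hcore := mem_hardSphereDomain.1 hζ j' j (Ne.symm hne)
    rw [Torus.geometry_sepVec] at hcore
    exact hcore.trans hmin
  have h := card_le_of_separated s (fun j => sepAt ζ p j) hε (by linarith) hR hsep
  have h125 : (2 * (2 * hsDiameter σ N) / hsDiameter σ N + 1) ^ 3 = (125 : ℝ) := by
    rw [show 2 * (2 * hsDiameter σ N) / hsDiameter σ N = 4 by field_simp; ring]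
    norm_num
  rwa [h125] at h

/-- **At most `125 (N+1)` ordered pairs in the near-contact shell** (hard-sphere domain,
`2 L κ ≤ 1`). [folklore] -/
theorem pairShellCount_le {L κ : ℝ} (hε : 0 < hsDiameter σ N) (hLκ : 2 * L * κ ≤ 1)
    {ζ : Config (N + 1) (Fin 3) T3} (hζ : ζ ∈ hardSphereDomain (Torus.geometry (Fin 3)) (N + 1) (hsDiameter σ N)) :
    pairShellCount σ N L κ ζ ≤ 125 * (N + 1 : ℝ) := by
  unfold pairShellCount
  calc ∑ i : Fin (N + 1), ∑ j : Fin (N + 1), shellInd σ N L κ ζ i j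
      = ∑ i : Fin (N + 1), shellCount σ N L κ ζ i := rfl
    _ ≤ ∑ _i : Fin (N + 1), (125 : ℝ) := Finset.sum_le_sum fun i _ => shellCount_le hε hLκ hζ i
    _ = 125 * (N + 1 : ℝ) := by
        rw [Finset.sum_const, Finset.card_univ, Fintype.card_fin, nsmul_eq_mul]
        push_cast
        ring

/-- The bad set of a hard-sphere flow is `localGibbsLaw`-null (the local Gibbs law has a density with
respect to the Liouville measure). [folklore] -/
theorem localGibbsLaw_goodCompl {σ : ℝ} {a₀ θ₀ : T3 → ℝ} {u₀ : T3 → V3} {N : ℕ}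
    (Φ : HardSphereFlow (Torus.geometry (Fin 3)) (hsDiameter σ N) (N + 1)) :
    localGibbsLaw σ a₀ u₀ θ₀ N Φ Φ.goodᶜ = 0 := by
  unfold localGibbsLaw particleLaw
  exact withDensity_absolutelyContinuous _ _ Φ.measure_compl_good

/-- **The late tube pairs carry `O(ε)`, deterministically.**  By packing, along every
good orbit `ε/(N+1) · pairShellCount (Φ_τ z) ≤ 125 ε_N → 0`; the bad set is `localGibbsLaw`-null.
[folklore] -/
theorem residual_latePairs :
    ∀ (a₀ θ₀ : T3 → ℝ) (u₀ : T3 → V3), Continuous a₀ → Continuous θ₀ → Continuous u₀ →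
      (∀ x, 0 < a₀ x) → (∀ x, 0 < θ₀ x) → ∃ σ₀ : ℝ, 0 < σ₀ ∧ ∀ σ : ℝ, 0 < σ → σ < σ₀ →
      ∀ Φ : (N : ℕ) → HardSphereFlow (Torus.geometry (Fin 3)) (hsDiameter σ N) (N + 1),
      ∀ τ : ℝ, 0 < τ → ∀ η δ : ℝ, 0 < η → 0 < δ →
      ∀ L : ℝ, 1 ≤ L → ∃ κ₀ : ℝ, 0 < κ₀ ∧ ∀ κ : ℝ, 0 < κ → κ < κ₀ → ∃ N₀ : ℕ, ∀ N : ℕ, N₀ ≤ N →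
        localGibbsLaw σ a₀ u₀ θ₀ N (Φ N)
          {z | η < hsDiameter σ N / (N + 1 : ℝ) * pairShellCount σ N L κ ((Φ N).flow τ z)}
          ≤ ENNReal.ofReal δ := by
  intro a₀ θ₀ u₀ _ _ _ _ _
  refine ⟨1, one_pos, ?_⟩
  intro σ hσ _ Φ τ _ η δ hη _ L hL
  have hL0 : 0 < L := one_pos.trans_le hL
  refine ⟨1 / (2 * L), by positivity, ?_⟩
  intro κ hκ hκlt
  have hLκ : 2 * L * κ ≤ 1 := by
    have : L * κ ≤ L * (1 / (2 * L)) := mul_le_mul_of_nonneg_left hκlt.le hL0.le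
    rw [show L * (1 / (2 * L)) = 1 / 2 by field_simp] at this
    linarith
  -- `125 ε_N ≤ η` as soon as `(N+1) ≥ (125 σ / η)³`, since `(N+1) ε_N³ = σ³`
  obtain ⟨N₀, hN₀⟩ := exists_nat_ge ((125 * σ / η) ^ 3)
  refine ⟨N₀, fun N hN => ?_⟩
  have hε := hsDiameter_pos hσ N
  have hN1 : (125 * σ / η) ^ 3 ≤ ((N + 1 : ℕ) : ℝ) := hN₀.trans (by exact_mod_cast hN.trans (Nat.le_succ N))
  have hεη : 125 * hsDiameter σ N ≤ η := by
    have hcube : (125 * hsDiameter σ N) ^ 3 ≤ η ^ 3 := by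
      have h3 := succ_mul_hsDiameter_pow_three σ N
      have : (125 * hsDiameter σ N) ^ 3 * ((N + 1 : ℕ) : ℝ) = (125 * σ) ^ 3 := by
        rw [mul_pow, mul_assoc, mul_comm (hsDiameter σ N ^ 3), h3]; ring
      have hpos : (0 : ℝ) < ((N + 1 : ℕ) : ℝ) := by positivity
      have h1 : (125 * σ) ^ 3 ≤ η ^ 3 * ((N + 1 : ℕ) : ℝ) := by
        have := mul_le_mul_of_nonneg_left hN1 (by positivity : (0 : ℝ) ≤ η ^ 3)
        rwa [div_pow, mul_div_cancel₀ _ (by positivity : (η : ℝ) ^ 3 ≠ 0)] at this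
      nlinarith
    exact le_of_pow_le_pow_left₀ (by norm_num) hη.le hcube
  -- on the good set the event is empty
  have hsub : {z | η < hsDiameter σ N / (N + 1 : ℝ) * pairShellCount σ N L κ ((Φ N).flow τ z)} ⊆ (Φ N).goodᶜ := by
    intro z hz hgood
    have hdom : (Φ N).flow τ z ∈ hardSphereDomain (Torus.geometry (Fin 3)) (N + 1) (hsDiameter σ N) :=
      (Φ N).good_subset ((Φ N).mapsTo_good τ hgood)
    have hP := pairShellCount_le (L := L) (κ := κ) hε hLκ hdom
    have hNpos : (0 : ℝ) < N + 1 := by positivity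
    have hle : hsDiameter σ N / (N + 1 : ℝ) * pairShellCount σ N L κ ((Φ N).flow τ z) ≤ η := by
      calc hsDiameter σ N / (N + 1 : ℝ) * pairShellCount σ N L κ ((Φ N).flow τ z)
          ≤ hsDiameter σ N / (N + 1 : ℝ) * (125 * (N + 1 : ℝ)) := mul_le_mul_of_nonneg_left hP (by positivity)
        _ = 125 * hsDiameter σ N := by field_simp
        _ ≤ η := hεη
    exact (not_lt.2 hle) hz
  calc localGibbsLaw σ a₀ u₀ θ₀ N (Φ N) {z | η < hsDiameter σ N / (N + 1 : ℝ) * pairShellCount σ N L κ ((Φ N).flow τ z)}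
      ≤ localGibbsLaw σ a₀ u₀ θ₀ N (Φ N) (Φ N).goodᶜ := measure_mono hsub
    _ = 0 := localGibbsLaw_goodCompl (Φ N)
    _ ≤ ENNReal.ofReal δ := bot_le

end Packing

end Literature.MathematicalPhysics.KineticTheory

end
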